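import Mathlib
import Literature.Computability.AlgebraicComplexity.StandardFamilies

/-!
# Integral relation of `T^m` over `(G_μ)` for line `Sketch` of crux `CertWindowQP`
(stmt-ValiantsHypothesis-5640)

Stub `stub_integralRel` of the registered skeleton. Given a homogeneous polynomial `F` of degree
`i` in variables `Y_μ` with `F(c) ≠ 0` and `F(P) = 0` (for scalars `c_μ` and elements `P_μ` of an
algebra `A`), the polynomial `Φ(Y, T) := F(Y + c·T)` in the variables `Y_μ` and one more variable
`T` is homogeneous of degree `i`, satisfies `Φ(0, 1) = F(c) ≠ 0`, and vanishes at
`Y_μ := φ(P_μ) - c_μ t`, `T := t` for any algebra map `φ` out of `A` and any `t`, because there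
`Y_μ + c_μ T ↦ φ(P_μ)`, so `Φ ↦ φ(F(P)) = 0`. This is the equation of integral dependence of
`T^m` over the ideal `(G_μ)_μ`, `G_μ = P_μ - c_μ T^m`, consumed by the Briançon–Skoda step.
Mathlib only.
-/

open MvPolynomial

namespace Summit.ValiantsHypothesis.ValiantsHypothesis.Theorems
set_option linter.dupNamespace false

open Literature.Computability.AlgebraicComplexity

/-- **Homogenised integral relation.** Let `F ∈ R[Y_μ : μ ∈ ι]` be homogeneous of degree `i`
with `F(c) ≠ 0` and `F(P) = 0` for `c : ι → R` and `P : ι → A`. Then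
`Φ(Y, T) := F(Y_μ + c_μ T)` (variables `Option ι`, `T = none`, `Y_μ = some μ`) is homogeneous of
degree `i`, `Φ(Y := 0, T := 1) ≠ 0`, and `Φ(Y_μ := φ(P_μ) - c_μ t, T := t) = 0` for every
`R`-algebra map `φ : A → R[τ]` and every `t ∈ R[τ]`. -/
theorem exists_isHomogeneous_integralRel_of_aeval_eq_zero {R ι A τ : Type*} [CommRing R]
    [CommRing A] [Algebra R A] (i : ℕ) (F : MvPolynomial ι R) (hF : F.IsHomogeneous i)
    (c : ι → R) (P : ι → A) (φ : A →ₐ[R] MvPolynomial τ R) (t : MvPolynomial τ R)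
    (hF0 : MvPolynomial.eval c F ≠ 0) (hFP : MvPolynomial.aeval P F = 0) :
    ∃ Φ : MvPolynomial (Option ι) R, Φ.IsHomogeneous i ∧
      MvPolynomial.eval (fun o : Option ι => o.elim 1 fun _ => 0) Φ ≠ 0 ∧
      MvPolynomial.aeval (fun o : Option ι => o.elim t fun μ : ι => φ (P μ) - C (c μ) * t) Φ = 0 := by
  -- `g μ = Y_μ + c_μ T`, `Φ = F(g)`.
  set g : ι → MvPolynomial (Option ι) R := fun μ => X (some μ) + C (c μ) * X none with hg
  refine ⟨aeval g F, ?_, ?_, ?_⟩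
  · -- each `g μ` is homogeneous of degree `1`
    simpa only [one_mul] using
      hF.aeval g fun μ => (isHomogeneous_X R (some μ)).add (isHomogeneous_C_mul_X (c μ) none)
  · -- `Φ(0, 1) = F(c)`
    have h : MvPolynomial.eval (fun o : Option ι => o.elim 1 fun _ => 0) (aeval g F) =
        MvPolynomial.eval c F := by
      have hc : (fun μ : ι => aeval (fun o : Option ι => o.elim 1 fun _ => 0) (g μ)) = c := by
        funext μ
        simp [hg]
      change aeval (fun o : Option ι => o.elim 1 fun _ => 0) (aeval g F) = aeval c F
      rw [comp_aeval_apply, hc]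
    rwa [h]
  · -- `Φ(φ P - c t, t) = φ (F(P)) = 0`
    rw [comp_aeval_apply]
    have h : (fun μ : ι => aeval (fun o : Option ι => o.elim t fun μ : ι => φ (P μ) - C (c μ) * t)
        (g μ)) = fun μ : ι => φ (P μ) := by
      funext μ
      simp [hg]
    rw [h, ← comp_aeval_apply, hFP, map_zero]

/-- **Registered stub `stub_integralRel`** of line `Sketch` (crux `CertWindowQP`,
stmt-ValiantsHypothesis-5640), verbatim signature of the registered skeleton; the special case of
`exists_isHomogeneous_integralRel_of_aeval_eq_zero` with `c_μ = coeff_μ per_n`,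
`P_μ = coeff_μ PDET` (the generic pencil determinant), `φ = rename some` and `t = T^m`. -/
theorem stub_integralRel (n m i : ℕ) (F : MvPolynomial ((Fin n × Fin n) →₀ ℕ) ℂ) (hF : F.IsHomogeneous i)
    (hF0 : MvPolynomial.eval (fun μ : (Fin n × Fin n) →₀ ℕ => MvPolynomial.coeff μ (perPoly (Fin n) ℂ)) F ≠ 0)
    (hFP : MvPolynomial.aeval (fun μ : (Fin n × Fin n) →₀ ℕ => MvPolynomial.coeff μ (Matrix.of fun i j : Fin m => MvPolynomial.C (MvPolynomial.X (none, (i, j))) + ∑ e : Fin n × Fin n, MvPolynomial.X e * MvPolynomial.C (MvPolynomial.X (some e, (i, j))) : Matrix (Fin m) (Fin m) (MvPolynomial (Fin n × Fin n) (MvPolynomial (Option (Fin n × Fin n) × (Fin m × Fin m)) ℂ))).det) F = 0) :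
    ∃ Φ : MvPolynomial (Option ((Fin n × Fin n) →₀ ℕ)) ℂ, Φ.IsHomogeneous i ∧
      MvPolynomial.eval (fun o : Option ((Fin n × Fin n) →₀ ℕ) => o.elim 1 fun _ => 0) Φ ≠ 0 ∧
      MvPolynomial.aeval (fun o : Option ((Fin n × Fin n) →₀ ℕ) => o.elim
        ((MvPolynomial.X none : MvPolynomial (Option (Option (Fin n × Fin n) × (Fin m × Fin m))) ℂ) ^ m)
        fun μ : (Fin n × Fin n) →₀ ℕ => MvPolynomial.rename some (MvPolynomial.coeff μ (Matrix.of fun i j : Fin m => MvPolynomial.C (MvPolynomial.X (none, (i, j))) + ∑ e : Fin n × Fin n, MvPolynomial.X e * MvPolynomial.C (MvPolynomial.X (some e, (i, j))) : Matrix (Fin m) (Fin m) (MvPolynomial (Fin n × Fin n) (MvPolynomial (Option (Fin n × Fin n) × (Fin m × Fin m)) ℂ))).det) - MvPolynomial.C (MvPolynomial.coeff μ (perPoly (Fin n) ℂ)) * MvPolynomial.X none ^ m) Φ = 0 :=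
  exists_isHomogeneous_integralRel_of_aeval_eq_zero i F hF _ _ (MvPolynomial.rename some)
    (MvPolynomial.X none ^ m) hF0 hFP

end Summit.ValiantsHypothesis.ValiantsHypothesis.Theorems
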